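import Summits.BirchSwinnertonDyer.BirchSwinnertonDyer.Theses.SemiOrdinaryEisensteinDescent
import Summits.BirchSwinnertonDyer.BirchSwinnertonDyer.Theorems.SemiOrdinaryEisensteinDescentWildSigmaDivisibilityAtThreeMultiCarrierManinThreeOfLeaf
import Summits.BirchSwinnertonDyer.BirchSwinnertonDyer.Theorems.SemiOrdinaryEisensteinDescentWildSigmaDivisibilityAtThreeMultiCarrierOfTwoPrintFacts
import HarnessLib

/-!
# Crux J‴ `WildSigmaDivisibilityAtThreeMultiCarrier` (stmt-BirchSwinnertonDyer-25898, SOED rev 25) — line `birth`, SKELETON v3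
# (lead-of-record lineage after the (155)(ii) re-key: width seat bsd-wall-soed-p2-w2 — v1 g5 06:11Z (223b1f81), v2 g7 09:40Z (07b0d11c6f7b), v3 g8 2026-08-28)

v3 CHANGE (g8; two print inputs RETIRED from the stubs, research content unchanged):
(a) **Poitou–Tate is GONE from the stubs.** The five-conjunct fact `∀ K, poitouTate_selmerStructure_duality_conj K` that v1/v2 carried as the
    first conjunct of `stub_printConj` is a THEOREM since 11:03Z: `poitouTate_selmerStructure_duality_conj_of_canonical_numberField K` (Literature
    `LocalInvariantMapConjCompatible`: `IsPerfect`, reciprocity and `IsConjCompatible` of THE canonical family) fed by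
    `unramifiedOrthogonal_of_isPerfect_allLevels _ canonical_isPerfect` and `selmerComplement_canonical_holds K n` (door-c4 g18 p626891
    `…PoitouTateReciprocitySumHolds`, Milne I 4.10(b) for THE maps, every `K`, `n`, from the E-side idèle package p624636 — cell `bsd-schneider`);
    the composition below is the width seat soed-p2-w3 g6's Theorems-level PT-free term `…OfTwoPrintFacts.…_of_twoPrintFacts` (11:25Z), which
    plugs exactly that theorem into p621905's composition.
(b) **The Manin stub is SPLIT at Cremona's bound.** `stub_maninThreeOffCremonaRange` = v2's `stub_maninThree` with the extra binder `500000 < N`;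
    on `N ≤ 500000` v2's text is Cremona's sentence `cremona_abs_maninConstant_eq_one_of_level_le_500000` (named fact, PRINT; per curve by p624569
    `…ManinThreeOfLeaf.maninThree_at_of_level_le_500000`), which moves INTO `stub_printConj`; the sorry-free glue `maninThree_of_cremona_of_offRange`
    (by cases on `N ≤ 500000`) restores v2's text for the composition. Every census class of row 2·3@3 (3 413 JET-PRODUCT / 3 894 onto wild r = 1)
    has `N < 5·10⁵`, so ON THE CENSUS HABITAT THE LINE'S ONLY NON-PRINT INPUT IS `stub_flatMultiCarrier`.

IDEA (unchanged). J‴ (σ-divisibility of the Kolyvagin classes to the full depth `t = ord₃ ∏ c_q + v₃ c(Dt)` on MULTI-CARRIER frames,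
Manin part counted) is SPLIT ALONG THE MANIN CONSTANT: by datum scaling (p600275 / p621905 §1) and the degree theorem every datum is an integer
multiple of a `3`-primitive one as soon as the `3`-primitive part of the constant is admissible; on a `3`-primitive datum a multi-carrier frame is
either a multi-TAMAGAWA-carrier frame (the research stub) or a single-Tamagawa-carrier frame, closed by Jetchev's max-form at `3 ∣ N` under `ρ̄₃`
onto ONLY — a KERNEL theorem modulo named print statements since the JET ModP series (p606426 `jetchevMaxModThree_of_literature`).
So J‴ ⟸ three stubs:
* `stub_flatMultiCarrier` (RESEARCH, the wall) — J‴'s own text with ONE extra binder `¬ (3:ℤ) ∣ Dt.c`: Jetchev 2008 Conj. 1.3 «≥» beyond the max at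
  the additive prime 3 on frames with ≥ 2 TAMAGAWA 3-carriers = Büyükboduk 2009 §4.2 Question 1; method-dead for local-condition refinements
  (barrier `StringentKolyvaginCapsAtMax`); the IMC/control evasion (BCGS 2023, Castella–Sano 2026, Zanella 2019) is void at the additive split 3
  (no bounded Λ-adic Heegner class: the 3-power CM tower on `X₀(N)` is trace-zero, `a₃ = 0`); TIGHT: ⟺ the ≤-half of BSD₃ on the cell mod print (p623556).
* `stub_maninThreeOffCremonaRange` (Manin₃ for the class, `500000 < N` only) — `3 ∤ c(D₀)` at the lattice-optimal `X₀(N)`-datum of the optimal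
  curve of the class = the conjecture leaf `ManinConstantOne`|₃ there (Edixhoven's method is void at wild 3, ČNS need `3 ∤ deg φ₀`); EMPTY on the
  census habitat.
* `stub_printConj` (PRINT) — `Gross1991_heegnerPoint_sub_ratTorsion_mem_E0` ∧ `GrossLMS1991.prop37_2_frobeniusCongruence` ∧
  `cremona_abs_maninConstant_eq_one_of_level_le_500000` (three published statements; Poitou–Tate no longer here).
Composition `WildSigmaDivisibilityAtThreeMultiCarrier_of` = w3 g6's
`WildSigmaDivisibilityAtThreeMultiCarrierOfTwoPrintFacts.wildSigmaDivisibilityAtThreeMultiCarrier_of_flatMultiCarrier_of_maninThree_of_twoPrintFacts`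
fed by the two Gross facts, the glued Manin text and the flat stub. Hardest stub: `stub_flatMultiCarrier` (crux-sized; no line in
print). `lean check`: rc 0, sorries = the three stubs only. BSD is not proved by any of this.
-/

set_option autoImplicit false
set_option linter.dupNamespace false

noncomputable section

open scoped Classical

namespace Summit.BirchSwinnertonDyer.BirchSwinnertonDyer.Cruxes.WildSigmaDivisibilityAtThreeMultiCarrier.Birth

open WeierstrassCurve NumberField Literature.NumberTheory.EllipticCurves
  Literature.NumberTheory.EllipticCurves.ModularForms Literature.NumberTheory.GaloisCohomology
  Summit.BirchSwinnertonDyer.Rank1Residual Summit.BirchSwinnertonDyer.Rank1Residual.Additive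
  Summit.BirchSwinnertonDyer.Rank1Residual.X11b.Three
  Summit.BirchSwinnertonDyer.BirchSwinnertonDyer.Theorems

/-! ## §1 Stubs -/

/-- STUB `stub_flatMultiCarrier` — unchanged (research). [cite: Jetchev2008, Conj. 1.3 (p. 812)] [cite: Buyukboduk2009TamagawaDefect, §4.2 Question 1] -/
theorem stub_flatMultiCarrier :
    ∀ (W : WeierstrassCurve ℚ) [W.IsElliptic] [W.IsGloballyMinimal] (N : ℕ) [NeZero N] (K : Type)
      [Field K] [NumberField K] (Dt : ModularParametrizationData W N)
      (H : HeegnerDatum N (NumberField.discr K)) (ι : K →+* ℂ) (P : (W.baseChange K).toAffine.Point),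
      ClassO6 W 3 → W.HasSurjectiveModNGaloisRep 3 → W.analyticRank = 1 → W.conductorNorm ℤ = N →
      IsImaginaryQuadratic K → SatisfiesHeegnerHypothesis N K →
      (W.quadraticTwist (NumberField.discr K : ℚ)).entireLFunction 1 ≠ 0 →
      WeierstrassCurve.Affine.Point.map ι.toRatAlgHom P = heegnerPointComplex Dt H →
      ¬ IsOfFinAddOrder P → Odd (NumberField.discr K) → NumberField.discr K ≠ -3 →
      ¬ (3 : ℤ) ∣ Dt.c →
      (∀ (q : ℕ) [Fact q.Prime], q ∣ N →
        padicValNat 3 ((W.baseChange ℚ_[q]).localTamagawaNumber ℤ_[q]) <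
          padicValNat 3 W.tamagawaProduct + padicValNat 3 Dt.c.natAbs) →
      ∀ (s' : ℕ), s' ≤ padicValNat 3 W.tamagawaProduct + padicValNat 3 Dt.c.natAbs →
        ∀ (n : ℕ) (d : KolyvaginHeegnerData Dt H.β ι n), Squarefree n →
          (∀ ℓ ∈ n.primeFactors, Zhang2014.IsKolyvaginPrime N W K 3 ℓ ∧
            s' ≤ Zhang2014.kolyvaginIndex W 3 ℓ) → Koly.PDiv d 3 s' := by
  sorry

/-- STUB `stub_maninThreeOffCremonaRange` (v3) — the v2 Manin text RESTRICTED to conductors `500000 < N` (off Cremona's tables):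
`3 ∤ c(D₀)` at the lattice-optimal `X₀(N)`-datum of the optimal curve of the class. = the conjecture leaf `ManinConstantOne`|₃ there
(Edixhoven's method is void at wild `3`, ČNS needs `3 ∤ deg φ₀`). [cite: AgasheRibetStein2006, §2] [cite: EdixhovenManin1991, §1] -/
theorem stub_maninThreeOffCremonaRange :
    ∀ (W : WeierstrassCurve ℚ) [W.IsElliptic] [W.IsGloballyMinimal] (N : ℕ) [NeZero N],
      ClassO6 W 3 → W.HasSurjectiveModNGaloisRep 3 → W.analyticRank = 1 → W.conductorNorm ℤ = N → 500000 < N →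
      ∀ (W₀ : WeierstrassCurve ℚ) [W₀.IsElliptic] [W₀.IsGloballyMinimal] (D₀ : ModularParametrizationData W₀ N),
        W.IsIsogenous W₀ → (∀ z ∈ D₀.L.lattice, ∃ w ∈ periodLattice D₀.f, z = D₀.c * w) → ¬ (3 : ℤ) ∣ D₀.c := by
  sorry

/-- STUB `stub_printConj` (v3) — THREE named print statements, Poitou–Tate GONE: Gross 1991 «Heegner point minus rational torsion
in E⁰», Gross 1991 Prop. 3.7 (2), and Cremona's sentence «`|c| = 1` for every lattice-optimal datum of level `≤ 500000`».
[cite: GrossLMS1991, Prop. 3.7 (2), §6] [cite: CesnaviciusNeururerSaha2023, §1 p. 2–3] -/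
theorem stub_printConj :
    Gross1991_heegnerPoint_sub_ratTorsion_mem_E0 ∧ GrossLMS1991.prop37_2_frobeniusCongruence ∧
      cremona_abs_maninConstant_eq_one_of_level_le_500000 := by
  sorry

/-! ## §2 Glue and the composition: the crux BY NAME from the three stubs -/

/-- The v2 Manin text (all conductors) from Cremona's sentence on `N ≤ 500000` and the off-range stub. -/
theorem maninThree_of_cremona_of_offRange (h500 : cremona_abs_maninConstant_eq_one_of_level_le_500000)
    (hoff : ∀ (W : WeierstrassCurve ℚ) [W.IsElliptic] [W.IsGloballyMinimal] (N : ℕ) [NeZero N],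
      ClassO6 W 3 → W.HasSurjectiveModNGaloisRep 3 → W.analyticRank = 1 → W.conductorNorm ℤ = N → 500000 < N →
      ∀ (W₀ : WeierstrassCurve ℚ) [W₀.IsElliptic] [W₀.IsGloballyMinimal] (D₀ : ModularParametrizationData W₀ N),
        W.IsIsogenous W₀ → (∀ z ∈ D₀.L.lattice, ∃ w ∈ periodLattice D₀.f, z = D₀.c * w) → ¬ (3 : ℤ) ∣ D₀.c) :
    ∀ (W : WeierstrassCurve ℚ) [W.IsElliptic] [W.IsGloballyMinimal] (N : ℕ) [NeZero N],
      ClassO6 W 3 → W.HasSurjectiveModNGaloisRep 3 → W.analyticRank = 1 → W.conductorNorm ℤ = N →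
      ∀ (W₀ : WeierstrassCurve ℚ) [W₀.IsElliptic] [W₀.IsGloballyMinimal] (D₀ : ModularParametrizationData W₀ N),
        W.IsIsogenous W₀ → (∀ z ∈ D₀.L.lattice, ∃ w ∈ periodLattice D₀.f, z = D₀.c * w) → ¬ (3 : ℤ) ∣ D₀.c := by
  intro W _ _ N _ hO6 hsurj hr hN W₀ _ _ D₀ hiso hopt
  by_cases h : N ≤ 500000
  · exact WildSigmaDivisibilityAtThreeMultiCarrierManinThreeOfLeaf.maninThree_at_of_level_le_500000 h500 h W₀ D₀ hopt
  · exact hoff W N hO6 hsurj hr hN (not_le.mp h) W₀ D₀ hiso hopt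

/-- **J‴ from the line's stubs** (v3): soed-p2-w3 g6's PT-free composition
`WildSigmaDivisibilityAtThreeMultiCarrierOfTwoPrintFacts.wildSigmaDivisibilityAtThreeMultiCarrier_of_flatMultiCarrier_of_maninThree_of_twoPrintFacts`
(= p621905's term with the Poitou–Tate input discharged by `selmerComplement_canonical_holds`, door-c4 g18 p626891) with the Manin input
fed by the Cremona glue `maninThree_of_cremona_of_offRange`. Sorry-free; the only sorries of the file are the three stubs.
[cite: Jetchev2008, Thm. 1.4 and Conj. 1.3 (p. 812)] [cite: AgasheRibetStein2006, §2 and Thm. 2.7] -/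
theorem WildSigmaDivisibilityAtThreeMultiCarrier_of :
    Summit.BirchSwinnertonDyer.BirchSwinnertonDyer.Theses.SemiOrdinaryEisensteinDescent.WildSigmaDivisibilityAtThreeMultiCarrier :=
  WildSigmaDivisibilityAtThreeMultiCarrierOfTwoPrintFacts.wildSigmaDivisibilityAtThreeMultiCarrier_of_flatMultiCarrier_of_maninThree_of_twoPrintFacts
    stub_printConj.1 stub_printConj.2.1
    (maninThree_of_cremona_of_offRange stub_printConj.2.2 stub_maninThreeOffCremonaRange) stub_flatMultiCarrier

end Summit.BirchSwinnertonDyer.BirchSwinnertonDyer.Cruxes.WildSigmaDivisibilityAtThreeMultiCarrier.Birth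

end
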